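import Mathlib.RingTheory.Norm.Transitivity
import Mathlib.NumberTheory.NumberField.InfinitePlace.Basic
import Mathlib.RingTheory.Ideal.Norm.AbsNorm
import Literature.NumberTheory.DiophantineGeometry.FaltingsHeight
import HarnessLib

/-!
# Faltings' isogeny inequality for elliptic curves: the global bookkeeping

Topic `NumberTheory/DiophantineGeometry`; a proofs-only sibling of `FaltingsHeight.lean`
(theorems only: no definitions, no named facts), serving the named fact
`WeierstrassCurve.stableFaltingsHeight_le_of_isogeny` (`h_F(E') ≤ h_F(E) + ½ log deg φ` for an
isogeny `φ : E → E'` over a number field `K`; Faltings 1983, §3 Lemma 5, recalled in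
Gaudron–Rémond 2014, §2.3).

## The printed proof and what is proved here

Faltings (Lemma 5 and its proof): over the ring of integers `R` of a field of semistable
reduction, `φ` extends to the Néron models and `φ^* : ω_{A₂} → ω_{A₁}` is an injective map of
metrized line bundles on `Spec R` whose norm at every infinite place is multiplied by
`√(deg φ)` (`‖φ^*α‖² = (i/2)∫ φ^*α ∧ φ^*ᾱ = deg φ · ‖α‖²`), whence
`h(A₂) = h(A₁) + ½ log deg φ − [K:ℚ]⁻¹ log #(ω_{A₁}/φ^*ω_{A₂})` and the last term is `≥ 0`.

For elliptic curves and the closed formula of the tree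
(`WeierstrassCurve.stableFaltingsHeight`:
`12[K:ℚ] h_F(E) = log N(𝔇) − Σ_{σ : K → ℂ} (log|σΔ_W| + 6 log covol(Λ_{W,σ}))`, `𝔇` the
denominator ideal of `j`, `Λ_{W,σ}` the period lattice of `ω_W = dx/(2y + a₁x + a₃)` under `σ`)
the same computation reads as follows. Write `φ^*ω_{W'} = α ω_W` with `α ∈ Kˣ` (Silverman,
*AEC*, III.5) and put `μ := Δ_{W'} α¹² / Δ_W ∈ Kˣ` (the ratio `φ^*β'/β` of Silverman's
coordinate-free sections `β = Δ ω^{⊗12}`, Silverman 1986, proof of Prop. 1.1). Then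

* (archimedean) for every `σ : K → ℂ` the isogeny is `z ↦ σ(α) z` on `ℂ/Λ_{W,σ} → ℂ/Λ_{W',σ}`
  with `σ(α)Λ_{W,σ} ⊆ Λ_{W',σ}` of index `deg φ` (*AEC* VI.4.1), so
  `|σα|² covol(Λ_{W,σ}) = deg φ · covol(Λ_{W',σ})` — this is `‖φ^*α‖² = deg φ ‖α‖²`;
* (finite) at every finite place `v`, `v(𝔇_{W'}) ≤ v(𝔇_W) + v(μ)` — this is the integrality of
  `φ^*` on Néron differentials over a field of semistable reduction, i.e. `#(ω/φ^*ω') ≥ 1`;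
  in particular `N(𝔇_{W'}) ≤ N(𝔇_W) · |N_{K/ℚ}(μ)|`;
* (global) by the product formula `Σ_σ log|σμ| = log|N_{K/ℚ} μ|`, and the two displays give
  `12[K:ℚ](h_F(E') − h_F(E)) = 6[K:ℚ] log deg φ + (log N𝔇' − log N𝔇 − log|Nμ|) ≤ 6[K:ℚ] log deg φ`.

This file proves the **global step** and the **lattice-theoretic form of the archimedean
step**, unconditionally:

* `Literature.NumberTheory.DiophantineGeometry.sum_log_norm_embedding_eq`: for `x ∈ Kˣ`,
  `Σ_{σ : K →+* ℂ} log‖σ x‖ = log|N_{K/ℚ}(x)|` (the archimedean half of the product formula,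
  Mathlib's `Algebra.norm_eq_prod_embeddings`);
* `Literature.NumberTheory.DiophantineGeometry.absNorm_mul_abs_norm_le`: for integral ideals
  `I, J` and `a, b ∈ 𝓞_K`, `I·(a) ⊆ J·(b)` implies `N(J)·|N(b)| ≤ N(I)·|N(a)|` (the finite step
  in norm form, from Mathlib's `Ideal.absNorm_dvd_absNorm_of_le`);
* `WeierstrassCurve.norm_sq_mul_complexPeriod_le_of_lattice_le`: if `aΛ ⊆ Λ'` has index `≤ n`
  for Néron-type period lattices `Λ, Λ'` of models `V, V'` over `ℂ`, then
  `|a|² · complexPeriod V ≤ n · complexPeriod V'` (Mathlib's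
  `ZLattice.covolume_div_covolume_eq_relIndex'` and the tree's
  `PeriodPair.covolume_mulLeft_lattice`);
* `WeierstrassCurve.stableFaltingsHeight_le_of_multiplier`: **the reduction** — for elliptic
  `W, W'` over `K`, `n ≥ 1` and `α ∈ Kˣ` satisfying the archimedean inequalities
  `|σα|² · complexPeriod(W^σ) ≤ n · complexPeriod(W'^σ)` for all `σ` and the finite inequality
  `N(𝔇_{W'}) ≤ N(𝔇_W)·|N_{K/ℚ}(Δ_{W'}α¹²/Δ_W)|`, one has `h_F(W') ≤ h_F(W) + ½ log n`.

What is **not** here (and keeps `stableFaltingsHeight_le_of_isogeny` a named fact): the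
existence of the multiplier `α ∈ K` of a `K`-isogeny with the archimedean property at every
embedding (analytic representation of the base-changed isogeny, *AEC* VI.4.1, with kernel of
order `deg φ`), and the finite inequality (Néron models / reduction of isogenies over a field of
semistable reduction). No statement of the tree is changed.

## References

* [Faltings1986FinitenessTranslation] G. Faltings, *Finiteness theorems for abelian varieties
  over number fields*, in Cornell–Silverman, *Arithmetic Geometry*, Ch. II, §3, Lemma 5 and its
  proof.
* [GaudronRemondPeriodes2014] É. Gaudron, G. Rémond, *Théorème des périodes et degrés minimaux
  d'isogénies*, Comment. Math. Helv. 89 (2014), §2.3 (the inequality recalled, any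
  normalisation).
* [Silverman1986] J. H. Silverman, *Heights and elliptic curves*, in Cornell–Silverman, Ch. X,
  Prop. 1.1 and its proof (the section `β = Δ ω^{⊗12}`).
* [SilvermanAEC2009] J. H. Silverman, *The Arithmetic of Elliptic Curves*, 2nd ed., III.5,
  Thm. VI.4.1.
-/

noncomputable section

open scoped Classical

namespace Literature.NumberTheory.DiophantineGeometry

open NumberField

variable {K : Type*} [Field K] [NumberField K]

/-- **Archimedean half of the product formula, logarithmic form.** For a non-zero element `x`
of a number field `K`, `Σ_{σ : K →+* ℂ} log |σ(x)| = log |N_{K/ℚ}(x)|`, since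
`N_{K/ℚ}(x) = ∏_σ σ(x)` (Mathlib `Algebra.norm_eq_prod_embeddings`). [folklore] -/
theorem sum_log_norm_embedding_eq {x : K} (hx : x ≠ 0) :
    ∑ σ : K →+* ℂ, Real.log ‖σ x‖ = Real.log |((Algebra.norm ℚ x : ℚ) : ℝ)| := by
  have hprod : ∏ σ : K →+* ℂ, ‖σ x‖ = |((Algebra.norm ℚ x : ℚ) : ℝ)| := by
    have h := congr_arg (‖·‖) (Algebra.norm_eq_prod_embeddings ℚ ℂ x)
    simp only [norm_prod] at h
    rw [← Fintype.prod_equiv RingHom.equivRatAlgHom (fun f => ‖f x‖) (fun φ => ‖φ x‖)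
      fun _ => by simp [RingHom.equivRatAlgHom_apply]] at h
    rw [← h, eq_ratCast, Complex.norm_ratCast]
  rw [← hprod, Real.log_prod]
  intro σ _
  exact norm_ne_zero_iff.mpr ((map_ne_zero σ).mpr hx)

/-- **The finite step in norm form.** For integral ideals `I ≠ 0`, `J` of `𝓞_K` and
`a ≠ 0`, `b` in `𝓞_K`, if `I·(a) ⊆ J·(b)` then `N(J)·|N_{K/ℚ}(b)| ≤ N(I)·|N_{K/ℚ}(a)|`: indeed
`N(J·(b)) = N(J)|N(b)|` divides `N(I·(a)) = N(I)|N(a)| ≠ 0` (Mathlib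
`Ideal.absNorm_dvd_absNorm_of_le`, `Ideal.absNorm_span_singleton`). With `c = a/b` this is the
passage from `v(J) ≤ v(I) + v(c)` at all finite `v` to `N(J) ≤ N(I)|N(c)|`. [folklore] -/
theorem absNorm_mul_abs_norm_le {I J : Ideal (𝓞 K)} {a b : 𝓞 K} (hI : I ≠ ⊥) (ha : a ≠ 0)
    (h : I * Ideal.span {a} ≤ J * Ideal.span {b}) :
    (Ideal.absNorm J : ℝ) * |((Algebra.norm ℚ (b : K) : ℚ) : ℝ)| ≤
      Ideal.absNorm I * |((Algebra.norm ℚ (a : K) : ℚ) : ℝ)| := by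
  have hdvd := Ideal.absNorm_dvd_absNorm_of_le h
  rw [map_mul, map_mul, Ideal.absNorm_span_singleton, Ideal.absNorm_span_singleton] at hdvd
  have hne : Ideal.absNorm I * (Algebra.norm ℤ a).natAbs ≠ 0 := by
    refine mul_ne_zero ?_ ?_
    · rwa [Ne, Ideal.absNorm_eq_zero_iff]
    · exact Int.natAbs_ne_zero.mpr (Algebra.norm_ne_zero_iff.mpr ha)
  have hle := Nat.le_of_dvd (Nat.pos_of_ne_zero hne) hdvd
  have hcast : ∀ c : 𝓞 K, |((Algebra.norm ℚ (c : K) : ℚ) : ℝ)| = ((Algebra.norm ℤ c).natAbs : ℝ) :=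
    fun c => by rw [← Algebra.coe_norm_int, Rat.cast_intCast, Nat.cast_natAbs, Int.cast_abs]
  rw [hcast, hcast]
  exact_mod_cast hle

end Literature.NumberTheory.DiophantineGeometry

namespace WeierstrassCurve

/-! ### The archimedean step, lattice form -/

section Complex

/-- **`‖φ^*α‖² = deg φ · ‖α‖²`, lattice form.** Let `V, V'` be Weierstrass models over `ℂ` with
Néron-type period pairs `L, L'` (`g₂ = c₄/12`, `g₃ = c₆/216`, so that
`complexPeriod = 2 covol`), and let `a ≠ 0` with `aΛ_L ⊆ Λ_{L'}` of index at most `n`. Then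
`|a|² · complexPeriod V ≤ n · complexPeriod V'`, with equality when the index is `n`:
`covol(aΛ) = |a|² covol(Λ)` (the tree's `PeriodPair.covolume_mulLeft_lattice`) and
`covol(aΛ) = [Λ' : aΛ] covol(Λ')` (Mathlib `ZLattice.covolume_div_covolume_eq_relIndex'`). For
the isogeny `z ↦ az : ℂ/Λ → ℂ/Λ'` of degree `[Λ' : aΛ]` (Silverman, *AEC*, Thm. VI.4.1) this is
the change of the metric `(i/2)∫ α ∧ ᾱ` under pull-back in Faltings' proof of Lemma 5.
(Dot-notation extension of Mathlib's `WeierstrassCurve`.)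
[cite: Faltings1986FinitenessTranslation, §3 Lemma 5 (proof)] -/
theorem norm_sq_mul_complexPeriod_le_of_lattice_le {V V' : WeierstrassCurve ℂ} {L L' : PeriodPair}
    (h₂ : L.g₂ = V.c₄ / 12) (h₃ : L.g₃ = V.c₆ / 216) (h₂' : L'.g₂ = V'.c₄ / 12)
    (h₃' : L'.g₃ = V'.c₆ / 216) {a : ℂ} (ha : a ≠ 0) (hle : (L.mulLeft a ha).lattice ≤ L'.lattice)
    {n : ℕ} (hn : (L.mulLeft a ha).lattice.toAddSubgroup.relIndex L'.lattice.toAddSubgroup ≤ n) :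
    ‖a‖ ^ 2 * V.complexPeriod ≤ n * V'.complexPeriod := by
  rw [V.complexPeriod_eq_two_mul_covolume' h₂ h₃, V'.complexPeriod_eq_two_mul_covolume' h₂' h₃']
  have hcov := ZLattice.covolume_div_covolume_eq_relIndex' (L.mulLeft a ha).lattice L'.lattice hle
  rw [L.covolume_mulLeft_lattice a ha] at hcov
  have hpos : 0 < ZLattice.covolume L'.lattice := ZLattice.covolume_pos _ _
  rw [div_eq_iff hpos.ne'] at hcov
  have hn' : ((L.mulLeft a ha).lattice.toAddSubgroup.relIndex L'.lattice.toAddSubgroup : ℝ) ≤ n := by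
    exact_mod_cast hn
  calc ‖a‖ ^ 2 * (2 * ZLattice.covolume L.lattice)
        = 2 * (((L.mulLeft a ha).lattice.toAddSubgroup.relIndex L'.lattice.toAddSubgroup : ℝ) *
            ZLattice.covolume L'.lattice) := by rw [← hcov]; ring
    _ ≤ 2 * ((n : ℝ) * ZLattice.covolume L'.lattice) := by gcongr
    _ = n * (2 * ZLattice.covolume L'.lattice) := by ring

/-- Equality case of `norm_sq_mul_complexPeriod_le_of_lattice_le`: if `aΛ ⊆ Λ'` has index
exactly `n` then `|a|² · complexPeriod V = n · complexPeriod V'` (`‖φ^*α‖² = deg φ ‖α‖²` for the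
isogeny `z ↦ az` of degree `n = [Λ' : aΛ]`, Silverman, *AEC*, Thm. VI.4.1; Faltings 1983, proof
of Lemma 5). [cite: Faltings1986FinitenessTranslation, §3 Lemma 5 (proof)] -/
theorem norm_sq_mul_complexPeriod_eq_of_lattice_le {V V' : WeierstrassCurve ℂ} {L L' : PeriodPair}
    (h₂ : L.g₂ = V.c₄ / 12) (h₃ : L.g₃ = V.c₆ / 216) (h₂' : L'.g₂ = V'.c₄ / 12)
    (h₃' : L'.g₃ = V'.c₆ / 216) {a : ℂ} (ha : a ≠ 0) (hle : (L.mulLeft a ha).lattice ≤ L'.lattice) :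
    ‖a‖ ^ 2 * V.complexPeriod =
      ((L.mulLeft a ha).lattice.toAddSubgroup.relIndex L'.lattice.toAddSubgroup) *
        V'.complexPeriod := by
  rw [V.complexPeriod_eq_two_mul_covolume' h₂ h₃, V'.complexPeriod_eq_two_mul_covolume' h₂' h₃']
  have hcov := ZLattice.covolume_div_covolume_eq_relIndex' (L.mulLeft a ha).lattice L'.lattice hle
  rw [L.covolume_mulLeft_lattice a ha] at hcov
  have hpos : 0 < ZLattice.covolume L'.lattice := ZLattice.covolume_pos _ _
  rw [div_eq_iff hpos.ne'] at hcov
  calc ‖a‖ ^ 2 * (2 * ZLattice.covolume L.lattice)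
        = 2 * (‖a‖ ^ 2 * ZLattice.covolume L.lattice) := by ring
    _ = ((L.mulLeft a ha).lattice.toAddSubgroup.relIndex L'.lattice.toAddSubgroup) *
        (2 * ZLattice.covolume L'.lattice) := by rw [hcov]; ring

end Complex

/-! ### The global step -/

section NumberField

open NumberField Literature.NumberTheory.DiophantineGeometry

variable {K : Type*} [Field K] [NumberField K]

/-- **Faltings' isogeny inequality from its two local inputs** (the global bookkeeping of
Faltings 1983, §3, proof of Lemma 5, for elliptic curves and the closed formula
`stableFaltingsHeight`). Let `W, W'` be elliptic curves over a number field `K`, `n ≥ 1`, and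
`α ∈ Kˣ` (in the application: `φ^*ω_{W'} = α ω_W` for a `K`-isogeny `φ : W → W'` of degree
`n`, Silverman *AEC* III.5) such that

* for every embedding `σ : K → ℂ`, `|σα|² · complexPeriod(W^σ) ≤ n · complexPeriod(W'^σ)`
  (`‖φ^*α‖² = deg φ · ‖α‖²`: `σ(α)Λ_{W,σ} ⊆ Λ_{W',σ}` with index `deg φ`, cf.
  `norm_sq_mul_complexPeriod_le_of_lattice_le`), and
* `N(𝔇_{W'}) ≤ N(𝔇_W) · |N_{K/ℚ}(Δ_{W'} α¹² / Δ_W)|` for the denominator ideals of `j`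
  (the finite places: `φ^*` is integral on Néron differentials, `#(ω/φ^*ω') ≥ 1`, cf.
  `absNorm_mul_abs_norm_le`).

Then `h_F(W') ≤ h_F(W) + ½ log n`. Proof: with `μ = Δ_{W'}α¹²/Δ_W`, each archimedean term
satisfies `archTerm(W'^σ) ≥ archTerm(W^σ) + log|σμ| − 6 log n`; summing over the `[K:ℚ]`
embeddings and using `Σ_σ log|σμ| = log|N_{K/ℚ}μ|` (`sum_log_norm_embedding_eq`) and the finite
hypothesis gives `12[K:ℚ] h_F(W') ≤ 12[K:ℚ] h_F(W) + 6[K:ℚ] log n`.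
(Dot-notation extension of Mathlib's `WeierstrassCurve`.)
[cite: Faltings1986FinitenessTranslation, §3 Lemma 5 (proof)] -/
theorem stableFaltingsHeight_le_of_multiplier (W W' : WeierstrassCurve K) [W.IsElliptic]
    [W'.IsElliptic] {n : ℕ} (hn : 0 < n) {α : K} (hα : α ≠ 0)
    (harch : ∀ σ : K →+* ℂ,
      ‖σ α‖ ^ 2 * (W.map σ).complexPeriod ≤ n * (W'.map σ).complexPeriod)
    (hfin : (Ideal.absNorm W'.jDenominatorIdeal : ℝ) ≤
      Ideal.absNorm W.jDenominatorIdeal *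
        |((Algebra.norm ℚ (W'.Δ * α ^ 12 / W.Δ) : ℚ) : ℝ)|) :
    W'.stableFaltingsHeight ≤ W.stableFaltingsHeight + 1 / 2 * Real.log n := by
  set μ : K := W'.Δ * α ^ 12 / W.Δ with hμ
  have hΔ : W.Δ ≠ 0 := W.isUnit_Δ.ne_zero
  have hΔ' : W'.Δ ≠ 0 := W'.isUnit_Δ.ne_zero
  have hμ0 : μ ≠ 0 := div_ne_zero (mul_ne_zero hΔ' (pow_ne_zero _ hα)) hΔ
  have hn0 : (0 : ℝ) < n := Nat.cast_pos.mpr hn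
  have hd : (0 : ℝ) < Module.finrank ℚ K := Nat.cast_pos.mpr Module.finrank_pos
  -- the archimedean terms, embedding by embedding
  have hσ : ∀ σ : K →+* ℂ, (W.map σ).faltingsArchTerm + Real.log ‖σ μ‖ - 6 * Real.log n ≤
      (W'.map σ).faltingsArchTerm := by
    intro σ
    have hcp : 0 < (W.map σ).complexPeriod := (W.map σ).complexPeriod_pos'
    have hcp' : 0 < (W'.map σ).complexPeriod := (W'.map σ).complexPeriod_pos'
    have hσα : 0 < ‖σ α‖ := norm_pos_iff.mpr ((map_ne_zero σ).mpr hα)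
    have hσΔ : 0 < ‖σ W.Δ‖ := norm_pos_iff.mpr ((map_ne_zero σ).mpr hΔ)
    have hσΔ' : 0 < ‖σ W'.Δ‖ := norm_pos_iff.mpr ((map_ne_zero σ).mpr hΔ')
    have h1 : Real.log (‖σ α‖ ^ 2 * (W.map σ).complexPeriod) ≤
        Real.log (n * (W'.map σ).complexPeriod) :=
      Real.log_le_log (by positivity) (harch σ)
    rw [Real.log_mul (by positivity) hcp.ne', Real.log_pow, Real.log_mul hn0.ne' hcp'.ne'] at h1
    have hlogμ : Real.log ‖σ μ‖ = Real.log ‖σ W'.Δ‖ + 12 * Real.log ‖σ α‖ - Real.log ‖σ W.Δ‖ := by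
      rw [hμ, map_div₀, map_mul, map_pow, norm_div, norm_mul, norm_pow,
        Real.log_div (by positivity) hσΔ.ne', Real.log_mul hσΔ'.ne' (by positivity), Real.log_pow]
      push_cast
      ring
    have h2 : Real.log ((W.map σ).complexPeriod / 2) =
        Real.log (W.map σ).complexPeriod - Real.log 2 := Real.log_div hcp.ne' two_ne_zero
    have h2' : Real.log ((W'.map σ).complexPeriod / 2) =
        Real.log (W'.map σ).complexPeriod - Real.log 2 := Real.log_div hcp'.ne' two_ne_zero
    simp only [faltingsArchTerm, map_Δ, h2, h2', hlogμ]
    push_cast at h1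
    linarith
  -- summing over the embeddings
  have hcard : (Finset.univ : Finset (K →+* ℂ)).card = Module.finrank ℚ K := by
    rw [Finset.card_univ, Embeddings.card]
  have hsum : ∑ σ : K →+* ℂ, (W.map σ).faltingsArchTerm +
      Real.log |((Algebra.norm ℚ μ : ℚ) : ℝ)| - 6 * Module.finrank ℚ K * Real.log n ≤
      ∑ σ : K →+* ℂ, (W'.map σ).faltingsArchTerm := by
    have h := Finset.sum_le_sum fun σ (_ : σ ∈ Finset.univ) => hσ σ
    rw [Finset.sum_sub_distrib, Finset.sum_add_distrib, sum_log_norm_embedding_eq hμ0,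
      Finset.sum_const, hcard, nsmul_eq_mul] at h
    linarith
  -- the finite part
  have hN : (0 : ℝ) < Ideal.absNorm W.jDenominatorIdeal := by
    have h0 : Ideal.absNorm W.jDenominatorIdeal ≠ 0 := by
      rw [Ne, Ideal.absNorm_eq_zero_iff]
      exact W.jDenominatorIdeal_ne_bot
    positivity
  have hN' : (0 : ℝ) < Ideal.absNorm W'.jDenominatorIdeal := by
    have h0 : Ideal.absNorm W'.jDenominatorIdeal ≠ 0 := by
      rw [Ne, Ideal.absNorm_eq_zero_iff]
      exact W'.jDenominatorIdeal_ne_bot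
    positivity
  have hNμ : (0 : ℝ) < |((Algebra.norm ℚ μ : ℚ) : ℝ)| := by
    rw [abs_pos, Rat.cast_ne_zero]
    exact Algebra.norm_ne_zero_iff.mpr hμ0
  have hlog : Real.log (Ideal.absNorm W'.jDenominatorIdeal) ≤
      Real.log (Ideal.absNorm W.jDenominatorIdeal) + Real.log |((Algebra.norm ℚ μ : ℚ) : ℝ)| := by
    rw [← Real.log_mul hN.ne' hNμ.ne']
    exact Real.log_le_log hN' hfin
  -- assembling
  have key : Real.log (Ideal.absNorm W'.jDenominatorIdeal) -
      ∑ σ : K →+* ℂ, (W'.map σ).faltingsArchTerm ≤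
      (Real.log (Ideal.absNorm W.jDenominatorIdeal) - ∑ σ : K →+* ℂ, (W.map σ).faltingsArchTerm) +
        6 * Module.finrank ℚ K * Real.log n := by
    linarith
  have h12 : (0 : ℝ) < 12 * Module.finrank ℚ K := by positivity
  unfold stableFaltingsHeight
  calc (12 * (Module.finrank ℚ K : ℝ))⁻¹ * (Real.log (Ideal.absNorm W'.jDenominatorIdeal) -
          ∑ σ : K →+* ℂ, (W'.map σ).faltingsArchTerm)
        ≤ (12 * (Module.finrank ℚ K : ℝ))⁻¹ *
          ((Real.log (Ideal.absNorm W.jDenominatorIdeal) -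
            ∑ σ : K →+* ℂ, (W.map σ).faltingsArchTerm) + 6 * Module.finrank ℚ K * Real.log n) :=
          mul_le_mul_of_nonneg_left key (inv_nonneg.mpr h12.le)
    _ = (12 * (Module.finrank ℚ K : ℝ))⁻¹ * (Real.log (Ideal.absNorm W.jDenominatorIdeal) -
            ∑ σ : K →+* ℂ, (W.map σ).faltingsArchTerm) + 1 / 2 * Real.log n := by
          field_simp
          ring

end NumberField

end WeierstrassCurve

end
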